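import Summits.CriticalPhenomena.SAWScalingLimit.Theorems.SAWLoopFugacityFlowAvoidanceLimitHarmonicExitRepresentation
import Literature.Probability.LatticeModels.BoundaryHarnackContraction
import HarnessLib

/-!
# The lattice adapter feeding Chelkak–Wan's iteration from the exit representation
— UBHP brick B-adapter of line `symplectic-fermion-anchor`
(crux `SAWLoopFugacityFlow.AvoidanceLimit`, stmt-CriticalPhenomena-10649)

The uniform boundary Harnack principle `stub_uniformBHP` of the line (edge-killed simple random
walk of a subgraph `H ≤ ℤ²` on a volume `Λ`, transition matrix `P = ¼·adjMat H Λ`) is proved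
along D. Chelkak, Y. Wan, Electron. J. Probab. 26 (2021), §3.2, Cor. 3.8: one iterates a one-step
contraction along a nested chain of vertex sets `S 0 ⊇ R 0 ⊇ S 1 ⊇ R 1 ⊇ ⋯ ⊇ S q`, where `R j` is
the `Λ`-interior of `S j` (every `H`-neighbour in `Λ` of a point of `R j` lies in `S j`). The
abstract iteration is `BoundaryHarnackContraction.crossDiff_iterate` (Literature); the present
file is the LATTICE ADAPTER:

* `transitionHarmonic_crossDiff_iterate` (registered signature) — for two nonnegative functions
  `h₁, h₂ : Λ → ℝ`, `P`-harmonic on `S 0`, and a constant `C ≥ 1` bounding the cross-ratios of the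
  exit kernels `x ↦ Σ_{w ∈ R j, w ∼_H x} G_{R j}(u, w)` (`u ∈ S (j+1)`, `x ∈ S j`), the symmetrised
  oscillation of `(h₁, h₂)` on `S q` is at most `k^q`, `k = (C − 1)/(C + 1)`:
  `|h₁(u)h₂(v) − h₁(v)h₂(u)| ≤ k^q (h₁(u)h₂(v) + h₁(v)h₂(u))`.

Proof: the exit representation `transitionHarmonic_eq_sum_greenEntry_mul` on `T = R j`,
`h(u) = Σ_{w ∈ R j} G_{R j}(u,w) · ¼ Σ_{x ∈ Λ ∖ R j, x ∼ w} h(x)`, is rewritten (swap of the two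
finite sums; an `H`-neighbour in `Λ` of `w ∈ R j` lies in `S j`) as
`h(u) = Σ_{x ∈ S j ∖ R j} K_j(u,x) h(x)` with `K_j(u,x) = ¼ Σ_{w ∈ R j, w ∼ x} G_{R j}(u,w) ≥ 0`
(`greenEntry_nonneg`), and `crossDiff_iterate` is applied on the index type `↥Λ` with the regions
`{z | j ≤ q ∧ z ∈ S j}` (empty beyond `q`). Sources: Chelkak–Wan 2021, Cor. 3.8 (bib key
`ChelkakWan2021`); folklore linear algebra. No definitions.
-/

noncomputable section

open scoped BigOperators Classical
open Finset
open Literature.Probability.RandomPlanarGeometry Literature.Probability.LatticeModels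

namespace Summit.CriticalPhenomena.SAWScalingLimit.Theorems.AvoidanceLimit.Anchor

/-- **Swapping the exit representation into kernel form.** For `T ⊆ Λ`, a superset `S'` of `T`
inside which all `Λ`-neighbours of `T`-points lie, and any `g : Site 2 → ℝ`, `h : Λ → ℝ`:
`Σ_{w ∈ T} g(w) · ¼ Σ_{x ∈ Λ ∖ T, x ∼ w} h(x) = Σ_{x ∈ Λ, x ∈ S' ∖ T} (¼ Σ_{w ∈ T, w ∼ x} g(w)) h(x)`.
[folklore] -/
theorem sum_mul_boundary_eq_sum_kernel_mul (H : SimpleGraph (Site 2)) (Λ T S' : Finset (Site 2))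
    (hT : ∀ w ∈ T, ∀ y ∈ Λ, H.Adj w y → y ∈ S') (g : Site 2 → ℝ) (h : ↥Λ → ℝ) :
    ∑ w ∈ T, g w * ((4 : ℝ)⁻¹ * ∑ x ∈ (Finset.univ : Finset ↥Λ).filter
        (fun x : ↥Λ => (x : Site 2) ∉ T ∧ H.Adj w (x : Site 2)), h x) =
      ∑ x ∈ (Finset.univ : Finset ↥Λ).filter
          (fun x : ↥Λ => (x : Site 2) ∈ S' ∧ (x : Site 2) ∉ T),
        ((4 : ℝ)⁻¹ * ∑ w ∈ T.filter (fun w => H.Adj w x), g w) * h x := by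
  simp_rw [Finset.mul_sum, Finset.sum_mul]
  rw [Finset.sum_comm' (s' := fun x : ↥Λ => T.filter (fun w => H.Adj w x))
    (t' := (Finset.univ : Finset ↥Λ).filter
      (fun x : ↥Λ => (x : Site 2) ∈ S' ∧ (x : Site 2) ∉ T))]
  · exact Finset.sum_congr rfl fun x _ => Finset.sum_congr rfl fun w _ => by ring
  · intro w x
    simp only [Finset.mem_filter, Finset.mem_univ, true_and]
    exact ⟨fun hh => ⟨⟨hh.1, hh.2.2⟩, hT w hh.1 x x.2 hh.2.2, hh.2.1⟩,
      fun hh => ⟨hh.1.1, hh.2.2, hh.1.2⟩⟩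

/-- **Registered brick B-adapter: Chelkak–Wan's iteration for the edge-killed walk.** Let
`H ≤ ℤ²`, `Λ` a volume, `S 0 ⊇ R 0 ⊇ S 1 ⊇ ⋯ ⊇ S q` a chain of vertex sets with `S 0 ⊆ Λ` and `R j`
the `Λ`-interior of `S j`, and let `h₁, h₂ ≥ 0` on `Λ` be `P`-harmonic (`P = ¼·adjMat H Λ`) on
`S 0`. If the exit kernels `x ↦ Σ_{w ∈ R j, w ∼_H x} G_{R j}(u, w)` (`G_{R j} = greenEntry H (R j)`)
have cross-ratios bounded by `C ≥ 1` for `u, v ∈ S (j+1)`, `x, y ∈ S j`, then for `u, v ∈ S q`,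
`|h₁(u)h₂(v) − h₁(v)h₂(u)| ≤ ((C−1)/(C+1))^q (h₁(u)h₂(v) + h₁(v)h₂(u))`
(`BoundaryHarnackContraction.crossDiff_iterate` fed by the exit representation
`transitionHarmonic_eq_sum_greenEntry_mul`). [cite: ChelkakWan2021, Corollary 3.8] -/
theorem transitionHarmonic_crossDiff_iterate :
    ∀ (H : SimpleGraph (Site 2)), H ≤ zdGraph 2 → ∀ (Λ : Finset (Site 2)) (S R : ℕ → Finset (Site 2)) (q : ℕ),
      S 0 ⊆ Λ → (∀ j, j < q → S (j + 1) ⊆ R j) →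
      (∀ j, j < q → ∀ z, z ∈ R j ↔ z ∈ S j ∧ ∀ y ∈ Λ, H.Adj z y → y ∈ S j) →
      ∀ (h₁ h₂ : ↥Λ → ℝ), (∀ x, 0 ≤ h₁ x) → (∀ x, 0 ≤ h₂ x) →
      (∀ x : ↥Λ, (x : Site 2) ∈ S 0 → Matrix.mulVec ((4 : ℝ)⁻¹ • adjMat H Λ) h₁ x = h₁ x) →
      (∀ x : ↥Λ, (x : Site 2) ∈ S 0 → Matrix.mulVec ((4 : ℝ)⁻¹ • adjMat H Λ) h₂ x = h₂ x) →
      ∀ C : ℝ, 1 ≤ C →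
      (∀ j, j < q → ∀ u v x y : ↥Λ, (u : Site 2) ∈ S (j + 1) → (v : Site 2) ∈ S (j + 1) →
        (x : Site 2) ∈ S j → (y : Site 2) ∈ S j →
        (∑ w ∈ (R j).filter (fun w => H.Adj w x), greenEntry H (R j) u w) *
          (∑ w ∈ (R j).filter (fun w => H.Adj w y), greenEntry H (R j) v w) ≤
        C * ((∑ w ∈ (R j).filter (fun w => H.Adj w x), greenEntry H (R j) v w) *
          (∑ w ∈ (R j).filter (fun w => H.Adj w y), greenEntry H (R j) u w))) →
      ∀ u v : ↥Λ, (u : Site 2) ∈ S q → (v : Site 2) ∈ S q →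
        |h₁ u * h₂ v - h₁ v * h₂ u| ≤ ((C - 1) / (C + 1)) ^ q * (h₁ u * h₂ v + h₁ v * h₂ u) := by
  intro H hH Λ S R q hS0 hSR hR h₁ h₂ hpos₁ hpos₂ hharm₁ hharm₂ C hC hcross u v hu hv
  -- nesting of the chain: `R j ⊆ S j ⊆ S 0 ⊆ Λ`
  have hRS : ∀ j, j < q → R j ⊆ S j := fun j hj z hz => ((hR j hj z).1 hz).1
  have hSS0 : ∀ j, j ≤ q → S j ⊆ S 0 := by
    intro j
    induction j with
    | zero => intro; exact Finset.Subset.refl _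
    | succ j ih =>
      intro hj
      exact ((hSR j hj).trans (hRS j hj)).trans (ih (Nat.le_of_succ_le hj))
  have hRΛ : ∀ j, j < q → R j ⊆ Λ := fun j hj => ((hRS j hj).trans (hSS0 j hj.le)).trans hS0
  -- the representation `h(u) = Σ_{x ∈ S j ∖ R j} K_j(u,x) h(x)` on `S (j+1)`, `j < q`
  have hrep : ∀ h : ↥Λ → ℝ,
      (∀ x : ↥Λ, (x : Site 2) ∈ S 0 → Matrix.mulVec ((4 : ℝ)⁻¹ • adjMat H Λ) h x = h x) →
      ∀ j, ∀ w ∈ ({z : ↥Λ | j + 1 ≤ q ∧ (z : Site 2) ∈ S (j + 1)} : Set ↥Λ),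
        h w = ∑ x ∈ (if j < q then (Finset.univ : Finset ↥Λ).filter
            (fun x : ↥Λ => (x : Site 2) ∈ S j ∧ (x : Site 2) ∉ R j) else ∅),
          ((4 : ℝ)⁻¹ * ∑ w' ∈ (R j).filter (fun w' => H.Adj w' x), greenEntry H (R j) w w') *
            h x := by
    intro h hharm j w hw
    obtain ⟨hjq, hwS⟩ := hw
    have hj : j < q := hjq
    rw [if_pos hj, transitionHarmonic_eq_sum_greenEntry_mul H hH Λ (R j) (hRΛ j hj) h
      (fun x hx => hharm x (hSS0 j hj.le (hRS j hj hx))) w (hSR j hj hwS)]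
    exact sum_mul_boundary_eq_sum_kernel_mul H Λ (R j) (S j)
      (fun w' hw' y hy hwy => ((hR j hj w').1 hw').2 y hy hwy) (greenEntry H (R j) w) h
  -- Chelkak–Wan's iteration on the index type `↥Λ`
  refine BoundaryHarnackContraction.crossDiff_iterate h₁ h₂
    (fun j => {z : ↥Λ | j ≤ q ∧ (z : Site 2) ∈ S j})
    (fun j => if j < q then (Finset.univ : Finset ↥Λ).filter
      (fun x : ↥Λ => (x : Site 2) ∈ S j ∧ (x : Site 2) ∉ R j) else ∅)
    (fun j w x => (4 : ℝ)⁻¹ * ∑ w' ∈ (R j).filter (fun w' => H.Adj w' x),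
      greenEntry H (R j) w w')
    hC (fun _ x _ => hpos₁ x) (fun _ x _ => hpos₂ x) ?_ ?_ (hrep h₁ hharm₁) (hrep h₂ hharm₂) ?_
    q u ⟨le_rfl, hu⟩ v ⟨le_rfl, hv⟩
  · -- `T j ⊆ S j`
    intro j x hx
    by_cases hj : j < q
    · rw [Finset.mem_coe, if_pos hj, Finset.mem_filter] at hx
      exact ⟨hj.le, hx.2.1⟩
    · rw [Finset.mem_coe, if_neg hj] at hx
      exact absurd hx (Finset.notMem_empty x)
  · -- nonnegativity of the kernel
    intro j w _ x _
    exact mul_nonneg (by norm_num) (Finset.sum_nonneg fun w' _ => greenEntry_nonneg hH _ _ _)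
  · -- the kernel cross-ratio bound
    intro j w hw w₂ hw₂ x hx y hy
    obtain ⟨hjq, hwS⟩ := hw
    have hj : j < q := hjq
    obtain ⟨-, hw₂S⟩ := hw₂
    rw [if_pos hj, Finset.mem_filter] at hx hy
    have key := hcross j hj w w₂ x y hwS hw₂S hx.2.1 hy.2.1
    have h4 : (0 : ℝ) ≤ 4⁻¹ * 4⁻¹ := by norm_num
    calc (4 : ℝ)⁻¹ * (∑ w' ∈ (R j).filter (fun w' => H.Adj w' x), greenEntry H (R j) w w') *
          ((4 : ℝ)⁻¹ * ∑ w' ∈ (R j).filter (fun w' => H.Adj w' y), greenEntry H (R j) w₂ w')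
        = 4⁻¹ * 4⁻¹ * ((∑ w' ∈ (R j).filter (fun w' => H.Adj w' x), greenEntry H (R j) w w') *
          (∑ w' ∈ (R j).filter (fun w' => H.Adj w' y), greenEntry H (R j) w₂ w')) := by ring
      _ ≤ 4⁻¹ * 4⁻¹ * (C * ((∑ w' ∈ (R j).filter (fun w' => H.Adj w' x),
            greenEntry H (R j) w₂ w') *
          (∑ w' ∈ (R j).filter (fun w' => H.Adj w' y), greenEntry H (R j) w w'))) :=
        mul_le_mul_of_nonneg_left key h4
      _ = C * ((4 : ℝ)⁻¹ * (∑ w' ∈ (R j).filter (fun w' => H.Adj w' x),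
            greenEntry H (R j) w₂ w') *
          ((4 : ℝ)⁻¹ * ∑ w' ∈ (R j).filter (fun w' => H.Adj w' y),
            greenEntry H (R j) w w')) := by ring

/-- **Exit form of the adapter** (the hypothesis actually consumed): as
`transitionHarmonic_crossDiff_iterate`, but the kernel cross-ratio bound is only required at EXIT
points `x, y ∈ S j ∖ R j` (the support of the exit kernel; at interior points the sums
`Σ_{w ∈ R j, w ∼ x} G_{R j}(u,w)` are Green's-function averages whose cross-ratios are NOT bounded
uniformly, so this is the form a lattice cross-ratio estimate can feed). Same proof.
[cite: ChelkakWan2021, Corollary 3.8] -/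
theorem transitionHarmonic_crossDiff_iterate_exit :
    ∀ (H : SimpleGraph (Site 2)), H ≤ zdGraph 2 → ∀ (Λ : Finset (Site 2)) (S R : ℕ → Finset (Site 2)) (q : ℕ),
      S 0 ⊆ Λ → (∀ j, j < q → S (j + 1) ⊆ R j) →
      (∀ j, j < q → ∀ z, z ∈ R j ↔ z ∈ S j ∧ ∀ y ∈ Λ, H.Adj z y → y ∈ S j) →
      ∀ (h₁ h₂ : ↥Λ → ℝ), (∀ x, 0 ≤ h₁ x) → (∀ x, 0 ≤ h₂ x) →
      (∀ x : ↥Λ, (x : Site 2) ∈ S 0 → Matrix.mulVec ((4 : ℝ)⁻¹ • adjMat H Λ) h₁ x = h₁ x) →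
      (∀ x : ↥Λ, (x : Site 2) ∈ S 0 → Matrix.mulVec ((4 : ℝ)⁻¹ • adjMat H Λ) h₂ x = h₂ x) →
      ∀ C : ℝ, 1 ≤ C →
      (∀ j, j < q → ∀ u v x y : ↥Λ, (u : Site 2) ∈ S (j + 1) → (v : Site 2) ∈ S (j + 1) →
        (x : Site 2) ∈ S j → (y : Site 2) ∈ S j → (x : Site 2) ∉ R j → (y : Site 2) ∉ R j →
        (∑ w ∈ (R j).filter (fun w => H.Adj w x), greenEntry H (R j) u w) *
          (∑ w ∈ (R j).filter (fun w => H.Adj w y), greenEntry H (R j) v w) ≤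
        C * ((∑ w ∈ (R j).filter (fun w => H.Adj w x), greenEntry H (R j) v w) *
          (∑ w ∈ (R j).filter (fun w => H.Adj w y), greenEntry H (R j) u w))) →
      ∀ u v : ↥Λ, (u : Site 2) ∈ S q → (v : Site 2) ∈ S q →
        |h₁ u * h₂ v - h₁ v * h₂ u| ≤ ((C - 1) / (C + 1)) ^ q * (h₁ u * h₂ v + h₁ v * h₂ u) := by
  intro H hH Λ S R q hS0 hSR hR h₁ h₂ hpos₁ hpos₂ hharm₁ hharm₂ C hC hcross u v hu hv
  -- nesting of the chain: `R j ⊆ S j ⊆ S 0 ⊆ Λ`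
  have hRS : ∀ j, j < q → R j ⊆ S j := fun j hj z hz => ((hR j hj z).1 hz).1
  have hSS0 : ∀ j, j ≤ q → S j ⊆ S 0 := by
    intro j
    induction j with
    | zero => intro; exact Finset.Subset.refl _
    | succ j ih =>
      intro hj
      exact ((hSR j hj).trans (hRS j hj)).trans (ih (Nat.le_of_succ_le hj))
  have hRΛ : ∀ j, j < q → R j ⊆ Λ := fun j hj => ((hRS j hj).trans (hSS0 j hj.le)).trans hS0
  -- the representation `h(u) = Σ_{x ∈ S j ∖ R j} K_j(u,x) h(x)` on `S (j+1)`, `j < q`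
  have hrep : ∀ h : ↥Λ → ℝ,
      (∀ x : ↥Λ, (x : Site 2) ∈ S 0 → Matrix.mulVec ((4 : ℝ)⁻¹ • adjMat H Λ) h x = h x) →
      ∀ j, ∀ w ∈ ({z : ↥Λ | j + 1 ≤ q ∧ (z : Site 2) ∈ S (j + 1)} : Set ↥Λ),
        h w = ∑ x ∈ (if j < q then (Finset.univ : Finset ↥Λ).filter
            (fun x : ↥Λ => (x : Site 2) ∈ S j ∧ (x : Site 2) ∉ R j) else ∅),
          ((4 : ℝ)⁻¹ * ∑ w' ∈ (R j).filter (fun w' => H.Adj w' x), greenEntry H (R j) w w') *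
            h x := by
    intro h hharm j w hw
    obtain ⟨hjq, hwS⟩ := hw
    have hj : j < q := hjq
    rw [if_pos hj, transitionHarmonic_eq_sum_greenEntry_mul H hH Λ (R j) (hRΛ j hj) h
      (fun x hx => hharm x (hSS0 j hj.le (hRS j hj hx))) w (hSR j hj hwS)]
    exact sum_mul_boundary_eq_sum_kernel_mul H Λ (R j) (S j)
      (fun w' hw' y hy hwy => ((hR j hj w').1 hw').2 y hy hwy) (greenEntry H (R j) w) h
  -- Chelkak–Wan's iteration on the index type `↥Λ`
  refine BoundaryHarnackContraction.crossDiff_iterate h₁ h₂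
    (fun j => {z : ↥Λ | j ≤ q ∧ (z : Site 2) ∈ S j})
    (fun j => if j < q then (Finset.univ : Finset ↥Λ).filter
      (fun x : ↥Λ => (x : Site 2) ∈ S j ∧ (x : Site 2) ∉ R j) else ∅)
    (fun j w x => (4 : ℝ)⁻¹ * ∑ w' ∈ (R j).filter (fun w' => H.Adj w' x),
      greenEntry H (R j) w w')
    hC (fun _ x _ => hpos₁ x) (fun _ x _ => hpos₂ x) ?_ ?_ (hrep h₁ hharm₁) (hrep h₂ hharm₂) ?_
    q u ⟨le_rfl, hu⟩ v ⟨le_rfl, hv⟩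
  · -- `T j ⊆ S j`
    intro j x hx
    by_cases hj : j < q
    · rw [Finset.mem_coe, if_pos hj, Finset.mem_filter] at hx
      exact ⟨hj.le, hx.2.1⟩
    · rw [Finset.mem_coe, if_neg hj] at hx
      exact absurd hx (Finset.notMem_empty x)
  · -- nonnegativity of the kernel
    intro j w _ x _
    exact mul_nonneg (by norm_num) (Finset.sum_nonneg fun w' _ => greenEntry_nonneg hH _ _ _)
  · -- the kernel cross-ratio bound
    intro j w hw w₂ hw₂ x hx y hy
    obtain ⟨hjq, hwS⟩ := hw
    have hj : j < q := hjq
    obtain ⟨-, hw₂S⟩ := hw₂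
    rw [if_pos hj, Finset.mem_filter] at hx hy
    have key := hcross j hj w w₂ x y hwS hw₂S hx.2.1 hy.2.1 hx.2.2 hy.2.2
    have h4 : (0 : ℝ) ≤ 4⁻¹ * 4⁻¹ := by norm_num
    calc (4 : ℝ)⁻¹ * (∑ w' ∈ (R j).filter (fun w' => H.Adj w' x), greenEntry H (R j) w w') *
          ((4 : ℝ)⁻¹ * ∑ w' ∈ (R j).filter (fun w' => H.Adj w' y), greenEntry H (R j) w₂ w')
        = 4⁻¹ * 4⁻¹ * ((∑ w' ∈ (R j).filter (fun w' => H.Adj w' x), greenEntry H (R j) w w') *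
          (∑ w' ∈ (R j).filter (fun w' => H.Adj w' y), greenEntry H (R j) w₂ w')) := by ring
      _ ≤ 4⁻¹ * 4⁻¹ * (C * ((∑ w' ∈ (R j).filter (fun w' => H.Adj w' x),
            greenEntry H (R j) w₂ w') *
          (∑ w' ∈ (R j).filter (fun w' => H.Adj w' y), greenEntry H (R j) w w'))) :=
        mul_le_mul_of_nonneg_left key h4
      _ = C * ((4 : ℝ)⁻¹ * (∑ w' ∈ (R j).filter (fun w' => H.Adj w' x),
            greenEntry H (R j) w₂ w') *
          ((4 : ℝ)⁻¹ * ∑ w' ∈ (R j).filter (fun w' => H.Adj w' y),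
            greenEntry H (R j) w w')) := by ring

end Summit.CriticalPhenomena.SAWScalingLimit.Theorems.AvoidanceLimit.Anchor

end
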